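import Summits.QuantumFields.GaugeBoot.ZdHolonomyGauge
import Summits.QuantumFields.GaugeBoot.GaugeInvariantLineAverages
import HarnessLib

/-!
# `ℤ^d`: gauge averages of closed-word line polynomials are multi-trace Wilson loops; the complex FFT (gauge-boot, FFT/ℤ^d 3/4)

HONEST FRAMING (cell `pub-gaugeboot`, page 1 of every file): the venture produces certified bounds
on lattice expectations at stated coupling, gauge group, dimension and torus size; NOT a mass gap,
NOT a continuum limit, NOT a string tension; NOT Yang–Mills-summit-bearing (barriers
`FixedCouplingUltralocality`, `PerturbativeInvisibility`). Structural; no number is certified.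
The `ℤ^d` twin of `GaugeInvariantLineAverages.lean`: the gauge group `ℤ^d → G` is an infinite
product of compact groups (compact, product Haar probability); a function of the gauge
transformation at ONE site integrates as a Haar integral over `G` because evaluation is a
continuous surjective homomorphism (Mathlib `MonoidHom.measurePreserving`).

## Content (`ℤ^d`, compact `G`, `r : LatticeRep G` with `SU(N) ⊆ ρ(G)`, `N ≥ 1`)

* `gaugeAvgCZd F U = ∫ F(U^γ) dγ`; `integral_gaugeGroupZd_eval`.
* ★★ `exists_mem_loopAlgebraCZd_gaugeAvgCZd_prod`, `exists_mem_loopAlgebraCZd_gaugeAvgCZd` — gauge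
  averages of (products of) closed-word line entries at the origin are multi-trace Wilson loops.
* ★★★ `mem_loopAlgebraCZd_of_isZdGaugeInvariant` — FIRST FUNDAMENTAL THEOREM on `ℤ^d`, complex
  form: a gauge-invariant complex polynomial (local) observable is a polynomial in the Wilson loops
  `tr ρ(hol_0 w)`, `w` closed at the origin.

References: B. Durhuus, Lett. Math. Phys. 4 (1980) 515–522; A. Sengupta, Proc. AMS 121 (1994)
897–905, Thm. 2.
-/

noncomputable section

namespace Summit.QuantumFields.GaugeBoot

open MeasureTheory Matrix Finset TensorFFT
open Literature.MathematicalPhysics.QuantumFieldTheory (LatticeRep haarProbability)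
open Literature.MathematicalPhysics.QuantumLattice (LGConfig ZdEdge gaugeTransformZd IsZdGaugeInvariant)
open Literature.Probability.LatticeModels (Site)

variable {d : ℕ} {G : Type*} [Group G] [TopologicalSpace G] [IsTopologicalGroup G]
  [CompactSpace G] [MeasurableSpace G] [BorelSpace G] [SecondCountableTopology G] (r : LatticeRep G)

/-! ## The gauge average on `ℤ^d` -/

section Avg

omit r

omit [CompactSpace G] [MeasurableSpace G] [BorelSpace G] [SecondCountableTopology G] in
/-- `γ ↦ U^γ` is continuous (`ℤ^d`). -/
theorem continuous_gaugeTransformZd_left (U : LGConfig d G) :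
    Continuous fun γ : Site d → G => gaugeTransformZd γ U :=
  continuous_pi fun e => (((continuous_apply e.1).mul continuous_const).mul
    (continuous_apply (e.1 + Pi.single e.2 1)).inv)

/-- **The gauge average on `ℤ^d`** `∫ F(U^γ) dγ` of a complex observable (as a function). [folklore] -/
def gaugeAvgCZd (F : C(LGConfig d G, ℂ)) (U : LGConfig d G) : ℂ :=
  ∫ γ, F (gaugeTransformZd γ U) ∂haarProbability (Site d → G)

/-- `gaugeAvgCZd` unfolded. -/
theorem gaugeAvgCZd_def (F : C(LGConfig d G, ℂ)) (U : LGConfig d G) :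
    gaugeAvgCZd F U = ∫ γ, F (gaugeTransformZd γ U) ∂haarProbability (Site d → G) := rfl

/-- The averaged integrand is integrable. -/
theorem integrable_comp_gaugeTransformZd (F : C(LGConfig d G, ℂ)) (U : LGConfig d G) :
    Integrable (fun γ : Site d → G => F (gaugeTransformZd γ U)) (haarProbability (Site d → G)) :=
  (F.continuous.comp (continuous_gaugeTransformZd_left U)).integrable_of_hasCompactSupport
    (HasCompactSupport.of_compactSpace _)

/-- `gaugeAvgCZd` is additive. -/
theorem gaugeAvgCZd_add (F₁ F₂ : C(LGConfig d G, ℂ)) (U : LGConfig d G) :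
    gaugeAvgCZd (F₁ + F₂) U = gaugeAvgCZd F₁ U + gaugeAvgCZd F₂ U := by
  simp only [gaugeAvgCZd_def, ContinuousMap.add_apply]
  exact integral_add (integrable_comp_gaugeTransformZd F₁ U) (integrable_comp_gaugeTransformZd F₂ U)

/-- `gaugeAvgCZd` is homogeneous. -/
theorem gaugeAvgCZd_smul (c : ℂ) (F : C(LGConfig d G, ℂ)) (U : LGConfig d G) :
    gaugeAvgCZd (c • F) U = c * gaugeAvgCZd F U := by
  simp only [gaugeAvgCZd_def, ContinuousMap.smul_apply, smul_eq_mul]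
  exact integral_const_mul c _

/-- `gaugeAvgCZd 0 = 0`. -/
theorem gaugeAvgCZd_zero (U : LGConfig d G) : gaugeAvgCZd (0 : C(LGConfig d G, ℂ)) U = 0 := by
  simp [gaugeAvgCZd_def]

/-- **The gauge average of a gauge-invariant observable is the observable** (`ℤ^d`). -/
theorem gaugeAvgCZd_of_isZdGaugeInvariant {F : C(LGConfig d G, ℂ)} (hF : IsZdGaugeInvariant (⇑F))
    (U : LGConfig d G) : gaugeAvgCZd F U = F U := by
  simp only [gaugeAvgCZd_def, hF _ U, integral_const, probReal_univ, one_smul]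

/-- ★ **A function of the gauge transformation at one site of `ℤ^d` integrates as a Haar integral
over `G`**: evaluation at `x` is a continuous surjective homomorphism of compact groups, hence
Haar-measure preserving (Mathlib `MonoidHom.measurePreserving`). -/
theorem integral_gaugeGroupZd_eval (x : Site d) (Φ : G → ℂ) (hΦ : Continuous Φ) :
    ∫ γ, Φ (γ x) ∂haarProbability (Site d → G) = ∫ g, Φ g ∂haarProbability G := by
  have hmp : MeasurePreserving (Pi.evalMonoidHom (fun _ : Site d => G) x)
      (haarProbability (Site d → G)) (haarProbability G) :=
    MonoidHom.measurePreserving (continuous_apply x)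
      (fun g => ⟨fun _ => g, rfl⟩) (by rw [measure_univ, measure_univ])
  have h2 : Measure.map (fun γ : Site d → G => γ x) (haarProbability (Site d → G)) = haarProbability G :=
    hmp.map_eq
  rw [← h2, integral_map (measurable_pi_apply x).aemeasurable hΦ.aestronglyMeasurable]

end Avg

/-! ## Gauge averages of products of closed-word line entries -/

section Prod

variable {r}

/-- ★★ **Gauge averages of products of closed-word line entries on `ℤ^d` are multi-trace Wilson
loops.** -/
theorem exists_mem_loopAlgebraCZd_gaugeAvgCZd_prod (hSU : ContainsSU r) (hN : 0 < r.N) {p : ℕ}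
    (w : Fin p → Word d) (hw : ∀ i, Word.endpointZd (0 : Site d) (w i) = 0) (a b : Fin p → Fin r.N) :
    ∃ H ∈ loopAlgebraCZd (d := d) r 0, ∀ U : LGConfig d G,
      H U = ∫ γ, ∏ i, r.ρ (wordHolonomyZd (gaugeTransformZd γ U) 0 (w i)) (a i) (b i)
        ∂haarProbability (Site d → G) := by
  obtain ⟨W, hW⟩ := exists_integral_prod_conj_eq (κ := Fin p) hSU hN
  have hT : ∀ τ : Equiv.Perm (Fin p), ∃ F ∈ loopAlgebraCZd (d := d) r 0,
      ∀ U : LGConfig d G, F U = twistTrace τ (fun i => r.ρ (wordHolonomyZd U 0 (w i))) :=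
    fun τ => exists_mem_loopAlgebraCZd_twistTrace r 0 p τ w hw
  choose F hF hFU using hT
  refine ⟨∑ σ : Equiv.Perm (Fin p), ∑ τ : Equiv.Perm (Fin p),
      (W σ τ * (permMat σ : Matrix (Fin p → Fin r.N) (Fin p → Fin r.N) ℂ) a b) • F τ,
    Subalgebra.sum_mem _ fun σ _ => Subalgebra.sum_mem _ fun τ _ => Subalgebra.smul_mem _ (hF τ) _,
    fun U => ?_⟩
  have hcov : ∀ γ : Site d → G, (∏ i, r.ρ (wordHolonomyZd (gaugeTransformZd γ U) 0 (w i)) (a i) (b i)) =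
      ∏ i, (r.ρ (γ 0) * r.ρ (wordHolonomyZd U 0 (w i)) * r.ρ (γ 0)⁻¹) (a i) (b i) := by
    intro γ
    refine prod_congr rfl fun i _ => ?_
    rw [wordHolonomyZd_gaugeTransformZd γ U 0 (w i), hw i, map_mul, map_mul]
  simp_rw [hcov]
  have hc : Continuous fun g : G => ∏ i, (r.ρ g * r.ρ (wordHolonomyZd U 0 (w i)) * r.ρ g⁻¹) (a i) (b i) :=
    continuous_finsetProd _ fun i _ =>
      ((r.continuous.mul continuous_const).mul (r.continuous.comp continuous_inv)).matrix_elem (a i) (b i)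
  rw [integral_gaugeGroupZd_eval (0 : Site d) _ hc, hW (fun i => r.ρ (wordHolonomyZd U 0 (w i))) a b]
  simp only [ContinuousMap.coe_sum, ContinuousMap.coe_smul, Finset.sum_apply, Pi.smul_apply,
    smul_eq_mul, hFU]

omit [CompactSpace G] [MeasurableSpace G] [BorelSpace G] [SecondCountableTopology G] in
/-- Elements of the submonoid generated by the closed-word line entries are products of such
entries (`ℤ^d`). -/
theorem exists_prodZd_of_mem_closure {m : C(LGConfig d G, ℂ)}
    (hm : m ∈ Submonoid.closure
      {f | ∃ (w : Word d) (a b : Fin r.N), Word.endpointZd (0 : Site d) w = 0 ∧ f = lineCZd r 0 w a b}) :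
    ∃ (p : ℕ) (w : Fin p → Word d) (a b : Fin p → Fin r.N), (∀ i, Word.endpointZd (0 : Site d) (w i) = 0) ∧
      ∀ U : LGConfig d G, m U = ∏ i, r.ρ (wordHolonomyZd U 0 (w i)) (a i) (b i) := by
  induction hm using Submonoid.closure_induction with
  | mem f hf =>
    obtain ⟨w, a, b, hw, rfl⟩ := hf
    exact ⟨1, fun _ => w, fun _ => a, fun _ => b, fun _ => hw, fun U => by simp⟩
  | one => exact ⟨0, Fin.elim0, Fin.elim0, Fin.elim0, fun i => i.elim0, fun U => by simp⟩
  | mul f g _ _ ihf ihg =>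
    obtain ⟨p, w, a, b, hw, hf⟩ := ihf
    obtain ⟨q, w', a', b', hw', hg⟩ := ihg
    refine ⟨p + q, Fin.append w w', Fin.append a a', Fin.append b b', fun i => ?_, fun U => ?_⟩
    · refine Fin.addCases (fun i => ?_) (fun i => ?_) i
      · simp only [Fin.append_left, hw]
      · simp only [Fin.append_right, hw']
    · rw [ContinuousMap.mul_apply, hf, hg, Fin.prod_univ_add]
      simp only [Fin.append_left, Fin.append_right]

/-- ★★ **The gauge average of every element of the line algebra at the origin of `ℤ^d` is a
multi-trace Wilson loop.** -/
theorem exists_mem_loopAlgebraCZd_gaugeAvgCZd (hSU : ContainsSU r) (hN : 0 < r.N)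
    {F : C(LGConfig d G, ℂ)} (hF : F ∈ lineAlgebraCZd (d := d) r 0) :
    ∃ H ∈ loopAlgebraCZd (d := d) r 0, ∀ U : LGConfig d G, H U = gaugeAvgCZd F U := by
  have hF' : F ∈ Subalgebra.toSubmodule (lineAlgebraCZd (d := d) r 0) := hF
  rw [lineAlgebraCZd, Algebra.adjoin_eq_span] at hF'
  clear hF
  refine Submodule.span_induction (p := fun f _ => ∃ H ∈ loopAlgebraCZd (d := d) r 0,
    ∀ U : LGConfig d G, H U = gaugeAvgCZd f U) ?_ ?_ ?_ ?_ hF'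
  · intro m hm
    obtain ⟨p, w, a, b, hw, hmU⟩ := exists_prodZd_of_mem_closure hm
    obtain ⟨H, hH, hHU⟩ := exists_mem_loopAlgebraCZd_gaugeAvgCZd_prod hSU hN w hw a b
    refine ⟨H, hH, fun U => ?_⟩
    rw [hHU, gaugeAvgCZd_def]
    simp only [hmU]
  · exact ⟨0, Subalgebra.zero_mem _, fun U => by rw [gaugeAvgCZd_zero]; rfl⟩
  · intro f g _ _ ihf ihg
    obtain ⟨H₁, h₁, h₁U⟩ := ihf
    obtain ⟨H₂, h₂, h₂U⟩ := ihg
    exact ⟨H₁ + H₂, Subalgebra.add_mem _ h₁ h₂, fun U => by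
      rw [ContinuousMap.add_apply, h₁U, h₂U, gaugeAvgCZd_add]⟩
  · intro c f _ ih
    obtain ⟨H, h, hU⟩ := ih
    exact ⟨c • H, Subalgebra.smul_mem _ h c, fun U => by
      rw [ContinuousMap.smul_apply, hU, gaugeAvgCZd_smul, smul_eq_mul]⟩

/-- ★★★ **FIRST FUNDAMENTAL THEOREM on `ℤ^d` (complex form)**: for a compact gauge group whose image
contains `SU(N)`, every gauge-invariant complex polynomial (local) observable in the link variables
of `ℤ^d` is a polynomial in the Wilson loops `tr ρ(hol_0 w)`, `w` closed at the origin. -/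
theorem mem_loopAlgebraCZd_of_isZdGaugeInvariant (hSU : ContainsSU r) (hN : 0 < r.N)
    {F : C(LGConfig d G, ℂ)} (hF : F ∈ polyAlgebraCZd (d := d) r) (hFi : IsZdGaugeInvariant (⇑F)) :
    F ∈ loopAlgebraCZd (d := d) r 0 := by
  obtain ⟨H, hH, hHU⟩ := exists_mem_loopAlgebraCZd_gaugeAvgCZd hSU hN
    (mem_lineAlgebraCZd_of_isZdGaugeInvariant r hF hFi)
  have e : F = H := ContinuousMap.ext fun U => by rw [hHU, gaugeAvgCZd_of_isZdGaugeInvariant hFi]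
  rw [e]
  exact hH

end Prod

end Summit.QuantumFields.GaugeBoot

end
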